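import Summits.QuantumFields.YangMills.Theorems.ContinuumLimitExists.Negative.OvercooledCanonicalScheme
import Summits.QuantumFields.YangMills.Theorems.ComplexCouplingChannelContinuumLegGivenGapAlternatingArraysDefs

/-!
# The over-cooled TRIADIC canonical scheme (tightness witness for the one-body ∃-stub of line `birth`, v6/v7)

Crux `ContinuumLimitExists` (stmt-QuantumFields-16124), line `birth` (`Cruxes/ContinuumLimitExists/Lines/birth.lean`),
continuation lead c3, 2026-08-17.  Companion of `OvercooledCanonicalScheme` (gen-0 lead, p154701): the same freezing
construction, with two changes dictated by the c3 reshape of the ∃-stub's UV clause (`UUVB` ⇐ one-body array-exponent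
bound CB + landed chessboard + Whitney step, `…ContinuumLimitExistsUvBoundsOfArrayExponent`, p164124):

* the tori are TRIADIC: `L_k = ⌊3^(k+2)/2⌋`, so `2L_k + 1 = 3^(k+2)` (`isTriadic_otL`) — the chessboard side of CB needs an
  alternating site/link-wall grid, which lives on odd tori of side a power of `3`;
* the freezing threshold at level `k` controls centred plaquette-string moments of EVERY length `1 ≤ p ≤ P_k`,
  `P_k = (2(2L_k+1))⁴` (an upper bound for the number `numCells⁴` of cells of any admissible level), by
  `ε_k = ((k+1)·((2L_k+1)⁴)^{P_k})⁻¹` — small enough to beat the `((2L_k+1)⁴)^{P}` lattice points of a `P`-cell array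
  (used in the companion file `OvercooledTriadicArrayExponent`, where CB is proved for this scheme).

This file: the scheme `overcooledT r` (`a_k = 1/(k+1)`, `L_k = otL k`, `β_k = otBeta r k ≥ k` beyond the level-`k`
threshold), and — verbatim the gen-0 arguments with the new threshold — weak coupling, polynomial volume growth (exponent
`1`), triadic tori, smallness `‖canonDistribution‖ ≤ |F|₀/(k+1)` of every canonical distribution of an alphabet string of
length `1 ≤ p ≤ P_k`, hence `ConvProducts`, `Rot345`, `CoreClustering` (all limits are `0`) and the failure of `ND2`, `ND3`.
No sorry; axioms standard.  (adapted from `…/Negative/OvercooledCanonicalScheme.lean`)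
-/

set_option autoImplicit false

noncomputable section

namespace Summit.QuantumFields.YangMills.Theorems.ContinuumLimitExists.Negative

open scoped SchwartzMap
open Filter Topology MeasureTheory Finset
open Literature.MathematicalPhysics.QuantumFieldTheory Literature.MathematicalPhysics.QuantumLattice
open Literature.MathematicalPhysics.AQFT Literature.Probability.LatticeModels
open Summit.QuantumFields.YangMills.Cruxes.ContinuumLimitOnTrajectory.TwoOrbitSynchronisation
open Summit.QuantumFields.YangMills.Theorems.TunedSequenceExists.Negative.Freezing
open Summit.QuantumFields.YangMills.Theorems.ContinuumLegGivenGap.AlternatingArrays (IsTriadic)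

variable {G : Type} [Group G] [TopologicalSpace G] [IsTopologicalGroup G] [CompactSpace G]
  [MeasurableSpace G] [BorelSpace G]

/-! ## §1 Triadic torus sizes, the moment-length budget and the threshold -/

/-- Torus half-side `L_k = ⌊3^(k+2)/2⌋`, so that the side `2L_k+1 = 3^(k+2)` is a power of three. [folklore] -/
def otL (k : ℕ) : ℕ := 3 ^ (k + 2) / 2

/-- `2 L_k + 1 = 3^(k+2)`. [folklore] -/
theorem two_mul_otL_add_one (k : ℕ) : 2 * otL k + 1 = 3 ^ (k + 2) := by
  have hodd : Odd (3 ^ (k + 2)) := Odd.pow (by decide : Odd 3)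
  have h1 : 1 ≤ 3 ^ (k + 2) := Nat.one_le_pow _ _ (by norm_num)
  unfold otL
  rw [Nat.two_mul_odd_div_two (Nat.odd_iff.1 hodd)]
  omega

/-- The tori of the scheme are triadic. [folklore] -/
theorem isTriadic_otL (k : ℕ) : IsTriadic (otL k) := ⟨k + 2, two_mul_otL_add_one k⟩

/-- `L_k` as a real number: `(3^(k+2) - 1)/2`. [folklore] -/
theorem otL_cast (k : ℕ) : (otL k : ℝ) = ((3 : ℝ) ^ (k + 2) - 1) / 2 := by
  have h := congrArg (fun n : ℕ => (n : ℝ)) (two_mul_otL_add_one k)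
  push_cast at h
  linarith

/-- `2(k+1)² + 1 ≤ 3^(k+2)` (real form). [folklore] -/
theorem two_mul_sq_add_one_le_pow (k : ℕ) : 2 * ((k : ℝ) + 1) ^ 2 + 1 ≤ (3 : ℝ) ^ (k + 2) := by
  induction k with
  | zero => norm_num
  | succ n ih =>
    have h3 : (3 : ℝ) ^ (n + 1 + 2) = 3 * 3 ^ (n + 2) := by ring
    rw [h3]
    push_cast
    nlinarith [ih, sq_nonneg (n : ℝ), Nat.cast_nonneg (α := ℝ) n]

/-- `(k+1)² ≤ L_k` (real form): the volume growth of the scheme. [folklore] -/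
theorem sq_le_otL (k : ℕ) : ((k : ℝ) + 1) ^ 2 ≤ (otL k : ℝ) := by
  rw [otL_cast]
  have h := two_mul_sq_add_one_le_pow k
  linarith

/-- Moment-length budget at level `k`: `P_k = (2(2L_k+1))⁴`, an upper bound for the cell count of every admissible level. [folklore] -/
def otP (k : ℕ) : ℕ := (2 * (2 * otL k + 1)) ^ 4

/-- `k ≤ P_k`. [folklore] -/
theorem le_otP (k : ℕ) : k ≤ otP k := by
  unfold otP
  have h1 : k ≤ 2 * (2 * otL k + 1) := by
    rw [two_mul_otL_add_one]
    have := (Nat.lt_pow_self (by norm_num : 1 < 3) (n := k + 2)).le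
    omega
  exact h1.trans (Nat.le_self_pow (by norm_num) _)

/-- The freezing tolerance `ε_k = ((k+1)·((2L_k+1)⁴)^{P_k})⁻¹` at level `k`. [folklore] -/
def otEps (k : ℕ) : ℝ := (((k : ℝ) + 1) * (((2 * (otL k : ℝ) + 1) ^ 4) ^ otP k))⁻¹

/-- `ε_k > 0`. [folklore] -/
theorem otEps_pos (k : ℕ) : 0 < otEps k := by
  unfold otEps
  positivity

/-- **Threshold at level `k`** (freezing of centred moments, gen-0): beyond some coupling, every centred moment of length
`1 ≤ p ≤ P_k` at positions in the box of the level-`k` torus is at most `ε_k`. [folklore] -/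
theorem exists_thresholdT (r : LatticeRep G) (k : ℕ) : ∃ T : ℝ, ∀ β : ℝ, T ≤ β →
    ∀ p : ℕ, p ≤ otP k → 1 ≤ p → ∀ (τ : Fin p → Option PlaqIdx) (x : Fin p → ↥(box 4 (otL k))),
      |centredMoment r (otL k) β p τ (fun i => (x i : Site 4))| ≤ otEps k :=
  Filter.eventually_atTop.1 (eventually_abs_centredMoment_le r (otL k) (otP k) (otEps_pos k))

/-- The over-cooled coupling `β_k = max(k, T_k)`. [folklore] -/
def otBeta (r : LatticeRep G) (k : ℕ) : ℝ := max (k : ℝ) (Classical.choose (exists_thresholdT r k))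

/-- `k ≤ β_k`. [folklore] -/
theorem le_otBeta (r : LatticeRep G) (k : ℕ) : (k : ℝ) ≤ otBeta r k := le_max_left _ _

/-- `β_k` is beyond the level-`k` threshold: every centred moment of length `1 ≤ p ≤ P_k` is at most `ε_k`. [folklore] -/
theorem otBeta_spec (r : LatticeRep G) {k p : ℕ} (hpk : p ≤ otP k) (hp : 1 ≤ p) (τ : Fin p → Option PlaqIdx)
    (x : Fin p → ↥(box 4 (otL k))) :
    |centredMoment r (otL k) (otBeta r k) p τ (fun i => (x i : Site 4))| ≤ otEps k :=
  Classical.choose_spec (exists_thresholdT r k) _ (le_max_right _ _) p hpk hp τ x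

/-! ## §2 The scheme -/

/-- **The over-cooled triadic canonical scheme** of `r`: `a_k = 1/(k+1)`, `L_k = ⌊3^(k+2)/2⌋`, `β_k = otBeta r k`
(`c`, `m` unused by the canonical vocabulary, set to `0`). [folklore] -/
def overcooledT (r : LatticeRep G) : SpeciesScheme (YMSpecies G) where
  a := fun k => ((k : ℝ) + 1)⁻¹
  a_pos := fun k => by positivity
  tendsto_a := tendsto_inv_atTop_zero.comp (tendsto_natCast_atTop_atTop.atTop_add tendsto_const_nhds)
  β := otBeta r
  L := otL
  tendsto_L := by
    refine tendsto_atTop_mono (f := fun k : ℕ => (k : ℝ) + 1) (fun k => ?_)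
      (tendsto_natCast_atTop_atTop.atTop_add tendsto_const_nhds)
    show (k : ℝ) + 1 ≤ ((k : ℝ) + 1)⁻¹ * (otL k : ℝ)
    have hk : (0 : ℝ) < (k : ℝ) + 1 := by positivity
    rw [← div_eq_inv_mul, le_div_iff₀ hk]
    have h := sq_le_otL k
    nlinarith
  c := fun _ _ => 0
  m := fun _ _ => 0

/-- The torus half-side of the scheme. [folklore] -/
@[simp] theorem overcooledT_L (r : LatticeRep G) (k : ℕ) : (overcooledT r).L k = otL k := rfl

/-- The coupling of the scheme. [folklore] -/
@[simp] theorem overcooledT_β (r : LatticeRep G) (k : ℕ) : (overcooledT r).β k = otBeta r k := rfl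

/-- The spacing of the scheme. [folklore] -/
@[simp] theorem overcooledT_a (r : LatticeRep G) (k : ℕ) : (overcooledT r).a k = ((k : ℝ) + 1)⁻¹ := rfl

/-- **Weak coupling**: `β_k ≥ k → ∞`. [folklore] -/
theorem hasWeakCouplingLimit_overcooledT (r : LatticeRep G) : (overcooledT r).HasWeakCouplingLimit :=
  tendsto_atTop_mono (le_otBeta r) tendsto_natCast_atTop_atTop

/-- The couplings are non-negative. [folklore] -/
theorem overcooledT_β_nonneg (r : LatticeRep G) (k : ℕ) : 0 ≤ (overcooledT r).β k :=
  (Nat.cast_nonneg k).trans (le_otBeta r k)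

/-- **Polynomial volume growth** with exponent `N = 1`: `a_k⁻¹ = k+1 ≤ L_k/(k+1) = a_k L_k`. [folklore] -/
theorem polyVolumeGrowth_overcooledT (r : LatticeRep G) : PolyVolumeGrowth (overcooledT r) := by
  refine ⟨1, le_rfl, Eventually.of_forall fun k => ?_⟩
  simp only [overcooledT_a, overcooledT_L, inv_inv, pow_one]
  have hk : (0 : ℝ) < (k : ℝ) + 1 := by positivity
  rw [← div_eq_inv_mul, le_div_iff₀ hk]
  have h := sq_le_otL k
  nlinarith

/-- **Triadic tori** at every level. [folklore] -/
theorem isTriadic_overcooledT (r : LatticeRep G) (k : ℕ) : IsTriadic ((overcooledT r).L k) := isTriadic_otL k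

/-! ## §3 Every canonical distribution of the scheme is small -/

/-- **Smallness**: for `1 ≤ p ≤ P_k`, every canonical lattice distribution of an alphabet string at level `k` is at most
`|F|₀/(k+1)`. [folklore] -/
theorem norm_canonDistribution_overcooledT_le (r : LatticeRep G) {k p : ℕ} (hp : 1 ≤ p) (hpk : p ≤ otP k)
    (τ : Fin p → Option PlaqIdx) (F : 𝓢((Fin p → EuclideanSpace ℝ (Fin 4)), ℂ)) :
    ‖canonDistribution r (overcooledT r) k p (fun i => obsOf r (τ i)) F‖ ≤ schwartzNorm 0 F / (k + 1) := by
  have h := norm_canonDistribution_obsOf_le r (overcooledT r) k p τ F (fun x => otBeta_spec r hpk hp τ x)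
  refine h.trans ?_
  simp only [overcooledT_L]
  have hs : (1 : ℝ) ≤ (2 * (otL k : ℝ) + 1) ^ 4 :=
    one_le_pow₀ (by have h0 : (0 : ℝ) ≤ 2 * (otL k : ℝ) := by positivity
                    linarith)
  have hpow : ((2 * (otL k : ℝ) + 1) ^ 4) ^ p ≤ ((2 * (otL k : ℝ) + 1) ^ 4) ^ otP k :=
    pow_le_pow_right₀ hs hpk
  have hk : (0 : ℝ) < (k : ℝ) + 1 := by positivity
  have hS : (0 : ℝ) < ((2 * (otL k : ℝ) + 1) ^ 4) ^ otP k := by positivity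
  have hN := schwartzNorm_nonneg 0 F
  unfold otEps
  rw [div_eq_mul_inv, mul_inv]
  calc ((2 * (otL k : ℝ) + 1) ^ 4) ^ p * schwartzNorm 0 F *
        (((k : ℝ) + 1)⁻¹ * (((2 * (otL k : ℝ) + 1) ^ 4) ^ otP k)⁻¹)
      = (((2 * (otL k : ℝ) + 1) ^ 4) ^ p * (((2 * (otL k : ℝ) + 1) ^ 4) ^ otP k)⁻¹) *
          (schwartzNorm 0 F * ((k : ℝ) + 1)⁻¹) := by ring
    _ ≤ 1 * (schwartzNorm 0 F * ((k : ℝ) + 1)⁻¹) := by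
        refine mul_le_mul_of_nonneg_right ?_ (by positivity)
        rw [mul_inv_le_iff₀ hS, one_mul]
        exact hpow
    _ = schwartzNorm 0 F * ((k : ℝ) + 1)⁻¹ := one_mul _

/-- The curvature string: every canonical curvature `p`-point distribution (`1 ≤ p ≤ P_k`) is at most `|F|₀/(k+1)`. [folklore] -/
theorem norm_curvDistribution_overcooledT_le (r : LatticeRep G) {k p : ℕ} (hp : 1 ≤ p) (hpk : p ≤ otP k)
    (F : 𝓢((Fin p → EuclideanSpace ℝ (Fin 4)), ℂ)) :
    ‖curvDistribution r (overcooledT r) k p F‖ ≤ schwartzNorm 0 F / (k + 1) := by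
  rw [← canonDistribution_curvature]
  exact norm_canonDistribution_overcooledT_le r hp hpk (fun _ => none) F

/-- A `k`-uniform bound including arity `0`: for `p ≤ P_k`, `‖curvDistribution‖ ≤ |F|₀`. [folklore] -/
theorem norm_curvDistribution_overcooledT_le' (r : LatticeRep G) {k p : ℕ} (hpk : p ≤ otP k)
    (F : 𝓢((Fin p → EuclideanSpace ℝ (Fin 4)), ℂ)) :
    ‖curvDistribution r (overcooledT r) k p F‖ ≤ schwartzNorm 0 F := by
  rcases Nat.eq_zero_or_pos p with rfl | hp
  · rw [curvDistribution_zero]; exact norm_le_schwartzNorm 0 F _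
  · refine (norm_curvDistribution_overcooledT_le r hp hpk F).trans ?_
    have hk : (1 : ℝ) ≤ (k : ℝ) + 1 := by
      have : (0 : ℝ) ≤ k := Nat.cast_nonneg k
      linarith
    exact div_le_self (schwartzNorm_nonneg 0 F) hk

/-- **All canonical curvature functions of the scheme tend to `0`** (`p ≥ 1`). [folklore] -/
theorem tendsto_curvDistribution_overcooledT (r : LatticeRep G) {p : ℕ} (hp : 1 ≤ p)
    (F : 𝓢((Fin p → EuclideanSpace ℝ (Fin 4)), ℂ)) :
    Tendsto (fun k => curvDistribution r (overcooledT r) k p F) atTop (𝓝 0) := by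
  have hlim : Tendsto (fun k : ℕ => schwartzNorm 0 F / ((k : ℝ) + 1)) atTop (𝓝 0) :=
    tendsto_const_nhds.div_atTop (tendsto_natCast_atTop_atTop.atTop_add tendsto_const_nhds)
  refine squeeze_zero_norm' ?_ hlim
  filter_upwards [eventually_ge_atTop p] with k hk
  exact norm_curvDistribution_overcooledT_le r hp (hk.trans (le_otP k)) F

/-! ## §4 What the scheme satisfies and what it violates -/

/-- **`ConvProducts` holds**: every canonical curvature `p`-point function on a real product tensor converges — to `0`. [folklore] -/
theorem convProducts_overcooledT (r : LatticeRep G) : ConvProducts r (overcooledT r) := by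
  intro p hp f _
  refine ⟨0, ?_⟩
  have ht := tendsto_curvDistribution_overcooledT r (Nat.one_le_iff_ne_zero.2 hp)
    (SchwartzMap.tensorFin p fun i => ofRealTest (f i))
  have hre := (Complex.continuous_re.tendsto 0).comp ht
  refine hre.congr fun k => ?_
  simp only [Function.comp_apply,
    curvDistribution_tensor r (overcooledT r) k p (isTensorOf_tensorFin fun i => ofRealTest (f i)),
    Complex.ofReal_re]

/-- **`ND2` fails**: no time-ordered pair has a canonical two-point distribution bounded away from `0`. [folklore] -/
theorem not_ND2_overcooledT (r : LatticeRep G) : ¬ ND2 r (overcooledT r) := by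
  rintro ⟨F, G₁, H, -, -, -, δ, hδ, hev⟩
  have ht := tendsto_curvDistribution_overcooledT r (p := 1 + 1) (by norm_num) H
  have hsmall : ∀ᶠ k in atTop, ‖curvDistribution r (overcooledT r) k (1 + 1) H‖ < δ := by
    filter_upwards [(Metric.tendsto_nhds.1 ht) δ hδ] with k hk
    simpa [dist_zero_right] using hk
  obtain ⟨k, h1, h2⟩ := (hev.and hsmall).exists
  exact absurd h1 (not_le.2 h2)

/-- **`ND3` fails**: no off-diagonal triple has a canonical three-point distribution bounded away from `0`. [folklore] -/
theorem not_ND3_overcooledT (r : LatticeRep G) : ¬ ND3 r (overcooledT r) := by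
  rintro ⟨f, g, h, F₃, -, -, δ, hδ, hev⟩
  have ht := tendsto_curvDistribution_overcooledT r (p := 3) (by norm_num) F₃
  have hsmall : ∀ᶠ k in atTop, ‖curvDistribution r (overcooledT r) k 3 F₃‖ < δ := by
    filter_upwards [(Metric.tendsto_nhds.1 ht) δ hδ] with k hk
    simpa [dist_zero_right] using hk
  obtain ⟨k, h1, h2⟩ := (hev.and hsmall).exists
  exact absurd h1 (not_le.2 h2)

/-- **`Rot345` holds (trivially)**: rotating the test function changes the canonical curvature distributions by `o(1)` —
both tend to `0`. [folklore] -/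
theorem rot345_overcooledT (r : LatticeRep G) : Rot345 r (overcooledT r) := by
  intro R _ _ _ _ p F _
  rcases Nat.eq_zero_or_pos p with rfl | hp
  · have h0 : ∀ k, curvDistribution r (overcooledT r) k 0 (linActMulti R F) -
        curvDistribution r (overcooledT r) k 0 F = 0 := fun k => by
      rw [curvDistribution_zero, curvDistribution_zero, linActMulti_apply, sub_eq_zero]
      exact congrArg F (Subsingleton.elim _ _)
    simp only [h0]
    exact tendsto_const_nhds
  · have h := (tendsto_curvDistribution_overcooledT r hp (linActMulti R F)).sub
      (tendsto_curvDistribution_overcooledT r hp F)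
    rwa [sub_zero] at h

/-- **`CoreClustering` holds (trivially)**: every clustering defect tends to `0` because every positive-arity canonical
distribution does, and the arity-`0` ones are evaluations. [folklore] -/
theorem coreClustering_overcooledT (r : LatticeRep G) : CoreClustering r (overcooledT r) := by
  intro n₁ n₂ Low Up _ _ crd _ P _ _ b _ _ ε hε
  refine ⟨0, fun t _ => ?_⟩
  set X := translateMulti (t • b) Up with hX
  have hdef : Tendsto (fun k => curvDistribution r (overcooledT r) k (n₁ + n₂) (Low.appendTensor X) -
      curvDistribution r (overcooledT r) k n₁ Low * curvDistribution r (overcooledT r) k n₂ X)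
      atTop (𝓝 0) := by
    rcases Nat.eq_zero_or_pos n₁ with rfl | h₁
    · rcases Nat.eq_zero_or_pos n₂ with rfl | h₂
      · have h0 : ∀ k, curvDistribution r (overcooledT r) k (0 + 0) (Low.appendTensor X) -
            curvDistribution r (overcooledT r) k 0 Low * curvDistribution r (overcooledT r) k 0 X = 0 := by
          intro k
          have e : curvDistribution r (overcooledT r) k (0 + 0) (Low.appendTensor X) =
              (Low.appendTensor X) default := curvDistribution_zero r (overcooledT r) k _
          rw [e, curvDistribution_zero, curvDistribution_zero, SchwartzMap.appendTensor_apply, sub_eq_zero]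
          exact congrArg₂ (· * ·) (congrArg Low (Subsingleton.elim _ _)) (congrArg X (Subsingleton.elim _ _))
        simp only [h0]
        exact tendsto_const_nhds
      · have hA := tendsto_curvDistribution_overcooledT r (p := 0 + n₂) (by omega) (Low.appendTensor X)
        have hB : Tendsto (fun k => curvDistribution r (overcooledT r) k 0 Low *
            curvDistribution r (overcooledT r) k n₂ X) atTop (𝓝 0) :=
          tendsto_mul_zero_of_bounded (M := schwartzNorm 0 Low)
            (Eventually.of_forall fun k => norm_curvDistribution_overcooledT_le' r (Nat.zero_le _) Low)
            (tendsto_curvDistribution_overcooledT r h₂ X)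
        simpa using hA.sub hB
    · have hA := tendsto_curvDistribution_overcooledT r (p := n₁ + n₂) (by omega) (Low.appendTensor X)
      have hB : Tendsto (fun k => curvDistribution r (overcooledT r) k n₁ Low *
          curvDistribution r (overcooledT r) k n₂ X) atTop (𝓝 0) := by
        have h := tendsto_mul_zero_of_bounded (M := schwartzNorm 0 X)
          (u := fun k => curvDistribution r (overcooledT r) k n₂ X)
          (v := fun k => curvDistribution r (overcooledT r) k n₁ Low) ?_
          (tendsto_curvDistribution_overcooledT r h₁ Low)
        · simpa [mul_comm] using h
        · filter_upwards [eventually_ge_atTop n₂] with k hk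
          exact norm_curvDistribution_overcooledT_le' r (hk.trans (le_otP k)) X
      simpa using hA.sub hB
  filter_upwards [(Metric.tendsto_nhds.1 hdef) ε hε] with k hk
  rw [dist_zero_right] at hk
  exact hk.le

/-- **Summary (this file)**: the over-cooled triadic scheme is a weak-coupling, polynomially growing scheme on triadic tori with
`ConvProducts ∧ Rot345 ∧ CoreClustering` and `¬ND2 ∧ ¬ND3`.  (CB for it: `…OvercooledTriadicArrayExponent`.) [folklore] -/
theorem exists_degenerate_triadic_scheme (r : LatticeRep G) :
    ∃ sch : SpeciesScheme (YMSpecies G), sch.HasWeakCouplingLimit ∧ PolyVolumeGrowth sch ∧ (∀ k, IsTriadic (sch.L k)) ∧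
      ConvProducts r sch ∧ Rot345 r sch ∧ CoreClustering r sch ∧ ¬ ND2 r sch ∧ ¬ ND3 r sch :=
  ⟨overcooledT r, hasWeakCouplingLimit_overcooledT r, polyVolumeGrowth_overcooledT r, isTriadic_overcooledT r,
    convProducts_overcooledT r, rot345_overcooledT r, coreClustering_overcooledT r, not_ND2_overcooledT r,
    not_ND3_overcooledT r⟩

end Summit.QuantumFields.YangMills.Theorems.ContinuumLimitExists.Negative

end
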